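import Mathlib
import Literature.MathematicalPhysics.StatisticalMechanics.BarlowStacking
import Literature.MathematicalPhysics.StatisticalMechanics.HaggStacking
import Literature.MathematicalPhysics.StatisticalMechanics.HcpHomogeneous
import Literature.MathematicalPhysics.StatisticalMechanics.HcpSiteGeometry

/-!
# Exact local hcp charts integrate to a global chart

Crux `PricedLinkCensus.StackingHinge` (stmt-AtomisticToContinuum-14993), line Sketch, stub
`stub_hcpChartsIntegrate` ("local rules ⇒ global structure" for the relaxed hexagonal close
packing `S = hcpStacking a h`, `0 < a`, `39/50 a ≤ h ≤ 17/20 a`): if a set `W ∋ 0` agrees, on the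
closed `r`-ball (`r ≥ 3a`) about each `w ∈ W` with `‖w‖ ≤ R`, with a rigid image of `S`, then `W`
agrees with ONE rigid image of `S` on the closed `R`-ball about `0`.  Steps:
`hcp_eq_of_norm_sq_eq` (the sites at distance `2h` from `0` are `±2h e₃`),
`hcp_mapsTo_of_mapsTo_ball` (site rigidity: a linear isometry mapping the sites of norm `≤ 2h`
to sites maps `S` into `S`), `charts_align` (overlapping exact charts have equal images, via
homogeneity `exists_recentre`), `hcpCharts_integrate` (induction along decreasing norm through
the base image, `exists_closer_hcp_site`, plus the covering bound `exists_hcp_site_near`).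
Elementary ([folklore]); hcp geometry as in Conway–Sloane, *SPLAG* Ch. 1 §1.3.
-/

namespace Summit.AtomisticToContinuum.Crystallization.Theorems.PricedHcpWindowsHcpCharts

open Literature.MathematicalPhysics.StatisticalMechanics

/-- The only hcp sites at distance `2h` from the origin are `±2h e₃`
(for `39/50 a ≤ h ≤ 17/20 a`). [folklore] -/
theorem hcp_eq_of_norm_sq_eq {a h : ℝ} (ha : 0 < a) (h1 : 39 / 50 * a ≤ h)
    (h2 : h ≤ 17 / 20 * a) {s : EuclideanSpace ℝ (Fin 3)} (hs : s ∈ hcpStacking a h)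
    (hn : ‖s‖ ^ 2 = 4 * h ^ 2) :
    s = barlowPos a h alternatingHagg 2 0 0 ∨ s = barlowPos a h alternatingHagg (-2) 0 0 := by
  obtain ⟨k, i, j, rfl⟩ := hs
  rw [hcp_norm_sq_eq] at hn
  have ha2 : 0 < a ^ 2 := by positivity
  have hh : 0 < h := by linarith
  obtain ⟨hlo, hhi⟩ : (39 / 50 * a) ^ 2 ≤ h ^ 2 ∧ h ^ 2 ≤ (17 / 20 * a) ^ 2 :=
    ⟨by nlinarith, by nlinarith⟩
  -- the in-layer part is nonnegative, whence `k² ≤ 4`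
  have hF : 0 ≤ (i : ℝ) ^ 2 + (i : ℝ) * j + (j : ℝ) ^ 2 +
      (haggLabel alternatingHagg k : ℝ) * ((i : ℝ) + j) +
        (haggLabel alternatingHagg k : ℝ) / 3 := by
    rcases haggLabel_alternating_eq_zero_or_one k with hL | hL <;> rw [hL] <;> push_cast
    · nlinarith [sq_nonneg (2 * (i : ℝ) + j), sq_nonneg (j : ℝ)]
    · nlinarith [sq_nonneg (2 * (i : ℝ) + j + 1), sq_nonneg (3 * (j : ℝ) + 1)]
  have hk2 : (k : ℝ) ^ 2 * h ^ 2 ≤ 4 * h ^ 2 := by nlinarith [mul_nonneg ha2.le hF]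
  have hk : k ^ 2 ≤ 4 := by exact_mod_cast (le_of_mul_le_mul_right hk2 (by positivity))
  obtain ⟨hkl, hku⟩ : -2 ≤ k ∧ k ≤ 2 := ⟨by nlinarith, by nlinarith⟩
  have hLm2 : haggLabel alternatingHagg (-2) = 0 := haggLabel_alternating_of_even (by decide)
  have hLm1 : haggLabel alternatingHagg (-1) = 1 := haggLabel_alternating_of_odd (by decide)
  have hL1 : haggLabel alternatingHagg 1 = 1 := haggLabel_alternating_of_odd (by decide)
  have hL2 : haggLabel alternatingHagg 2 = 0 := haggLabel_alternating_of_even (by decide)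
  -- even layers `±2`: the in-layer form vanishes
  have even_case :
      a ^ 2 * ((i : ℝ) ^ 2 + (i : ℝ) * j + (j : ℝ) ^ 2) = 0 → i = 0 ∧ j = 0 := fun h0 => by
    have hF0 : i ^ 2 + i * j + j ^ 2 = 0 := by
      exact_mod_cast (mul_eq_zero.1 h0).resolve_left ha2.ne'
    by_contra hne
    have := one_le_sq_add_mul_add_sq (p := i) (q := j) (by simpa [Prod.ext_iff] using hne)
    omega
  -- layer `0`: `a² F = 4h²` has no integer solution `F`
  have zero_case : a ^ 2 * ((i : ℝ) ^ 2 + (i : ℝ) * j + (j : ℝ) ^ 2) ≠ 4 * h ^ 2 := by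
    intro h0
    rcases le_or_gt (i ^ 2 + i * j + j ^ 2) 2 with hc | hc
    · have hc' : (i : ℝ) ^ 2 + (i : ℝ) * j + (j : ℝ) ^ 2 ≤ 2 := by exact_mod_cast hc
      nlinarith [mul_le_mul_of_nonneg_left hc' ha2.le]
    · have hc' : (3 : ℝ) ≤ (i : ℝ) ^ 2 + (i : ℝ) * j + (j : ℝ) ^ 2 := by
        exact_mod_cast hc
      nlinarith [mul_le_mul_of_nonneg_left hc' ha2.le]
  -- layers `±1`: `a² (G + 1/3) = 3h²` has no integer solution `G`
  have one_case :
      a ^ 2 * ((i : ℝ) ^ 2 + (i : ℝ) * j + (j : ℝ) ^ 2 + ((i : ℝ) + j) + 1 / 3) ≠ 3 * h ^ 2 := by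
    intro h0
    rcases le_or_gt (i ^ 2 + i * j + j ^ 2 + (i + j)) 1 with hc | hc
    · have hc' : (i : ℝ) ^ 2 + (i : ℝ) * j + (j : ℝ) ^ 2 + ((i : ℝ) + j) ≤ 1 := by
        exact_mod_cast hc
      nlinarith [mul_le_mul_of_nonneg_left hc' ha2.le]
    · have hc' : (2 : ℝ) ≤ (i : ℝ) ^ 2 + (i : ℝ) * j + (j : ℝ) ^ 2 + ((i : ℝ) + j) := by
        exact_mod_cast hc
      nlinarith [mul_le_mul_of_nonneg_left hc' ha2.le]
  interval_cases k <;> push_cast [hLm2, hLm1, hL1, hL2, haggLabel_zero] at hn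
  · obtain ⟨rfl, rfl⟩ := even_case (by linarith); exact Or.inr rfl
  · exact absurd (by linarith) one_case
  · exact absurd (by linarith) zero_case
  · exact absurd (by linarith) one_case
  · obtain ⟨rfl, rfl⟩ := even_case (by linarith); exact Or.inl rfl

/-- **Site rigidity of hcp**: a linear isometry of `ℝ³` that maps the hcp sites of norm `≤ 2h` to
hcp sites maps every hcp site to an hcp site (for `39/50 a ≤ h ≤ 17/20 a`). [folklore] -/
theorem hcp_mapsTo_of_mapsTo_ball {a h : ℝ} (ha : 0 < a) (h1 : 39 / 50 * a ≤ h)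
    (h2 : h ≤ 17 / 20 * a) (ψ : EuclideanSpace ℝ (Fin 3) ≃ₗᵢ[ℝ] EuclideanSpace ℝ (Fin 3))
    (hψ : ∀ z ∈ hcpStacking a h, ‖z‖ ≤ 2 * h → ψ z ∈ hcpStacking a h) :
    ∀ z ∈ hcpStacking a h, ψ z ∈ hcpStacking a h := by
  have hh : 0 < h := by linarith
  have hL1 : haggLabel alternatingHagg 1 = 1 := haggLabel_alternating_of_odd odd_one
  have hL2 : haggLabel alternatingHagg 2 = 0 := haggLabel_alternating_of_even even_two
  have hLm2 : haggLabel alternatingHagg (-2) = 0 := haggLabel_alternating_of_even (by decide)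
  -- reference sites `u = (0,1,0)`, `v = (0,0,1)`, `p = (1,0,0)`, `n = (2,0,0)` (as `(k,i,j)`)
  have norm_le : ∀ k i j : ℤ, ‖barlowPos a h alternatingHagg k i j‖ ^ 2 ≤ 4 * h ^ 2 →
      ‖barlowPos a h alternatingHagg k i j‖ ≤ 2 * h := fun k i j hle => by
    nlinarith [norm_nonneg (barlowPos a h alternatingHagg k i j)]
  have hu : ‖barlowPos a h alternatingHagg 0 1 0‖ ≤ 2 * h :=
    norm_le 0 1 0 (by rw [hcp_norm_sq_eq, haggLabel_zero]; push_cast; nlinarith)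
  have hv : ‖barlowPos a h alternatingHagg 0 0 1‖ ≤ 2 * h :=
    norm_le 0 0 1 (by rw [hcp_norm_sq_eq, haggLabel_zero]; push_cast; nlinarith)
  have hp : ‖barlowPos a h alternatingHagg 1 0 0‖ ≤ 2 * h :=
    norm_le 1 0 0 (by rw [hcp_norm_sq_eq, hL1]; push_cast; nlinarith)
  have hn2 : ‖barlowPos a h alternatingHagg 2 0 0‖ ^ 2 = 4 * h ^ 2 := by
    rw [hcp_norm_sq_eq, hL2]; push_cast; ring
  -- Step 1: `ψ n = ε n`, `ε = ±1`
  obtain ⟨ε, hε1, hεn⟩ : ∃ ε : ℝ, ε ^ 2 = 1 ∧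
      ψ (barlowPos a h alternatingHagg 2 0 0) = ε • barlowPos a h alternatingHagg 2 0 0 := by
    have hmem := hψ _ (barlowPos_mem 2 0 0) (norm_le 2 0 0 hn2.le)
    have hnorm : ‖ψ (barlowPos a h alternatingHagg 2 0 0)‖ ^ 2 = 4 * h ^ 2 := by
      rw [LinearIsometryEquiv.norm_map, hn2]
    rcases hcp_eq_of_norm_sq_eq ha h1 h2 hmem hnorm with he | he
    · exact ⟨1, by norm_num, by rw [he, one_smul]⟩
    · refine ⟨-1, by norm_num, ?_⟩
      rw [he]
      ext l
      fin_cases l <;> simp [hL2, hLm2]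
  -- Step 2: third coordinates transform by `ε` (polarisation against `n`)
  have hcoord : ∀ x, ψ x 2 = ε * x 2 := by
    intro x
    have e1 : ψ (x - ε • barlowPos a h alternatingHagg 2 0 0) =
        ψ x - barlowPos a h alternatingHagg 2 0 0 := by
      rw [map_sub, LinearIsometryEquiv.map_smul, hεn, smul_smul, ← sq, hε1, one_smul]
    have e2 : ‖ψ x - barlowPos a h alternatingHagg 2 0 0‖ ^ 2 =
        ‖x - ε • barlowPos a h alternatingHagg 2 0 0‖ ^ 2 := by
      rw [← e1, LinearIsometryEquiv.norm_map]
    have e3 : ‖ψ x‖ ^ 2 = ‖x‖ ^ 2 := by rw [LinearIsometryEquiv.norm_map]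
    rw [EuclideanSpace.real_norm_sq_eq, EuclideanSpace.real_norm_sq_eq, Fin.sum_univ_three,
      Fin.sum_univ_three] at e2 e3
    simp only [PiLp.sub_apply, PiLp.smul_apply, smul_eq_mul, barlowPos_apply_zero,
      barlowPos_apply_one, barlowPos_apply_two, hL2] at e2
    push_cast at e2
    have key : 4 * h * (ψ x 2 - ε * x 2) = 0 := by
      linear_combination (-1 : ℝ) * e2 + e3 - 4 * h ^ 2 * hε1
    have h4 : (4 : ℝ) * h ≠ 0 := by positivity
    exact sub_eq_zero.1 ((mul_eq_zero.1 key).resolve_left h4)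
  -- Step 3: the layers of the images of the reference sites
  have layer : ∀ (x : EuclideanSpace ℝ (Fin 3)) (k i j : ℤ),
      ψ x = barlowPos a h alternatingHagg k i j → (k : ℝ) * h = ε * x 2 := by
    intro x k i j hx
    rw [← barlowPos_apply_two a h alternatingHagg k i j, ← hx, hcoord]
  have layer0 : ∀ (x : EuclideanSpace ℝ (Fin 3)) (k i j : ℤ), x 2 = 0 →
      ψ x = barlowPos a h alternatingHagg k i j → k = 0 := by
    intro x k i j hx2 hx
    have e := layer _ _ _ _ hx
    rw [hx2, mul_zero] at e
    exact_mod_cast (mul_eq_zero.1 e).resolve_right hh.ne'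
  obtain ⟨k₁, i₁, j₁, hu'⟩ := hψ _ (barlowPos_mem 0 1 0) hu
  obtain ⟨k₂, i₂, j₂, hv'⟩ := hψ _ (barlowPos_mem 0 0 1) hv
  obtain ⟨k₃, i₃, j₃, hp'⟩ := hψ _ (barlowPos_mem 1 0 0) hp
  have hk₁ : k₁ = 0 := layer0 _ _ _ _ (by simp) hu'
  have hk₂ : k₂ = 0 := layer0 _ _ _ _ (by simp) hv'
  have hk₃ : (k₃ : ℝ) = ε := by
    have e := layer _ _ _ _ hp'
    rw [barlowPos_apply_two] at e
    push_cast at e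
    exact mul_right_cancel₀ hh.ne' (by linear_combination e)
  subst hk₁ hk₂ hk₃
  have hk3 : k₃ = 1 ∨ k₃ = -1 := by
    have hsq : k₃ ^ 2 = 1 := by exact_mod_cast hε1
    exact mul_self_eq_one_iff.mp (by rw [← pow_two]; exact hsq)
  have hodd : Odd k₃ := by rcases hk3 with rfl | rfl <;> decide
  have hLk3 : haggLabel alternatingHagg k₃ = 1 := haggLabel_alternating_of_odd hodd
  -- Step 4: the image of a general site
  rintro z ⟨k, i, j, rfl⟩
  have hLk : haggLabel alternatingHagg (k₃ * k) = haggLabel alternatingHagg k := by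
    rcases Int.even_or_odd k with hk | hk
    · rw [haggLabel_alternating_of_even hk, haggLabel_alternating_of_even (hk.mul_left k₃)]
    · rw [haggLabel_alternating_of_odd hk, haggLabel_alternating_of_odd (hodd.mul hk)]
  have hdec : barlowPos a h alternatingHagg k i j =
      (i : ℝ) • barlowPos a h alternatingHagg 0 1 0 +
        (j : ℝ) • barlowPos a h alternatingHagg 0 0 1 +
        (haggLabel alternatingHagg k : ℝ) • barlowPos a h alternatingHagg 1 0 0 +
        (((k : ℝ) - haggLabel alternatingHagg k) / 2) •
          barlowPos a h alternatingHagg 2 0 0 := by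
    ext l; fin_cases l <;> simp [hL1, hL2] <;> ring
  simp only [hdec, map_add, LinearIsometryEquiv.map_smul, hu', hv', hp', hεn]
  refine ⟨k₃ * k, i * i₁ + j * i₂ + haggLabel alternatingHagg k * i₃,
    i * j₁ + j * j₂ + haggLabel alternatingHagg k * j₃, ?_⟩
  ext l; fin_cases l <;> simp [hL2, hLk, hLk3] <;> ring

/-- **Recentring a rigid image of hcp** (homogeneity): a rigid image `g '' hcp` is also
`G '' hcp` for a rigid motion `G` taking the origin to any prescribed point `g z`, `z ∈ hcp`.
[folklore] -/
theorem exists_recentre {a h : ℝ} (g : EuclideanSpace ℝ (Fin 3) ≃ᵃⁱ[ℝ] EuclideanSpace ℝ (Fin 3))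
    {z : EuclideanSpace ℝ (Fin 3)} (hz : z ∈ hcpStacking a h) :
    ∃ G : EuclideanSpace ℝ (Fin 3) ≃ᵃⁱ[ℝ] EuclideanSpace ℝ (Fin 3),
      G 0 = g z ∧ G '' hcpStacking a h = g '' hcpStacking a h := by
  obtain ⟨B, hB⟩ := hcpStacking_homogeneous a h hz
  refine ⟨(B.toAffineIsometryEquiv.trans
    (AffineIsometryEquiv.constVAdd ℝ (EuclideanSpace ℝ (Fin 3)) z)).trans g, by simp, ?_⟩
  ext x
  simp only [Set.mem_image, AffineIsometryEquiv.coe_trans, Function.comp_apply,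
    AffineIsometryEquiv.coe_constVAdd, LinearIsometryEquiv.coe_toAffineIsometryEquiv,
    vadd_eq_add]
  constructor
  · rintro ⟨y, hy, rfl⟩
    exact ⟨z + B y, (hB y).1 hy, rfl⟩
  · rintro ⟨s, hs, rfl⟩
    refine ⟨B.symm (s - z), (hB _).2 ?_, ?_⟩
    · simpa using hs
    · simp

/-- **One-sided alignment**: if two rigid motions `G, G'` agree at `0` and `G` maps the hcp
sites of norm `≤ 2h` into `G' '' hcp`, then `G '' hcp ⊆ G' '' hcp`. [folklore] -/
theorem image_subset_image_of_local {a h : ℝ} (ha : 0 < a) (h1 : 39 / 50 * a ≤ h)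
    (h2 : h ≤ 17 / 20 * a) (G G' : EuclideanSpace ℝ (Fin 3) ≃ᵃⁱ[ℝ] EuclideanSpace ℝ (Fin 3))
    (h0 : G 0 = G' 0)
    (H : ∀ z ∈ hcpStacking a h, ‖z‖ ≤ 2 * h → G z ∈ G' '' hcpStacking a h) :
    G '' hcpStacking a h ⊆ G' '' hcpStacking a h := by
  have hψ0 : (G.trans G'.symm).toIsometryEquiv 0 = 0 := by simp [h0]
  have hT : ∀ z ∈ hcpStacking a h, ‖z‖ ≤ 2 * h →
      (G.trans G'.symm).toIsometryEquiv.toRealLinearIsometryEquivOfMapZero hψ0 z ∈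
        hcpStacking a h := by
    intro z hz hzn
    obtain ⟨y, hy, hye⟩ := H z hz hzn
    have : (G.trans G'.symm).toIsometryEquiv.toRealLinearIsometryEquivOfMapZero hψ0 z =
        G'.symm (G z) := rfl
    rw [this, ← hye, AffineIsometryEquiv.symm_apply_apply]
    exact hy
  rintro _ ⟨z, hz, rfl⟩
  exact ⟨_, hcp_mapsTo_of_mapsTo_ball ha h1 h2 _ hT z hz, by simp⟩

/-- **Overlapping exact charts are aligned**: if `gp`, `gq` are exact `r`-charts of `W` at `p`,
`q`, with `dist p q + 2h ≤ r`, `q ∈ W` and `q ∈ gp '' hcp`, then `gp '' hcp = gq '' hcp`.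
[folklore] -/
theorem charts_align {a h r : ℝ} (ha : 0 < a) (h1 : 39 / 50 * a ≤ h) (h2 : h ≤ 17 / 20 * a)
    {W : Set (EuclideanSpace ℝ (Fin 3))} {p q : EuclideanSpace ℝ (Fin 3)}
    {gp gq : EuclideanSpace ℝ (Fin 3) ≃ᵃⁱ[ℝ] EuclideanSpace ℝ (Fin 3)}
    (C1p : ∀ w' ∈ W, dist p w' ≤ r → w' ∈ gp '' hcpStacking a h)
    (C2p : ∀ z ∈ hcpStacking a h, dist p (gp z) ≤ r → gp z ∈ W)
    (C1q : ∀ w' ∈ W, dist q w' ≤ r → w' ∈ gq '' hcpStacking a h)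
    (C2q : ∀ z ∈ hcpStacking a h, dist q (gq z) ≤ r → gq z ∈ W)
    (hpq : dist p q + 2 * h ≤ r) (hqW : q ∈ W) (hq : q ∈ gp '' hcpStacking a h) :
    gp '' hcpStacking a h = gq '' hcpStacking a h := by
  have hh : 0 < h := by linarith
  have hd : 0 ≤ dist p q := dist_nonneg
  have C2p' : ∀ x ∈ gp '' hcpStacking a h, dist p x ≤ r → x ∈ W := by
    rintro _ ⟨z, hz, rfl⟩ hd; exact C2p z hz hd
  have C2q' : ∀ x ∈ gq '' hcpStacking a h, dist q x ≤ r → x ∈ W := by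
    rintro _ ⟨z, hz, rfl⟩ hd; exact C2q z hz hd
  obtain ⟨zp, hzp, hzpe⟩ := hq
  obtain ⟨zq, hzq, hzqe⟩ := C1q q hqW (by rw [dist_self]; linarith)
  obtain ⟨Gp, hGp0, hGpS⟩ := exists_recentre gp hzp
  obtain ⟨Gq, hGq0, hGqS⟩ := exists_recentre gq hzq
  rw [hzpe] at hGp0; rw [hzqe] at hGq0; clear C2p C2q
  rw [← hGpS] at C1p C2p' ⊢
  rw [← hGqS] at C1q C2q' ⊢
  have key : ∀ G : EuclideanSpace ℝ (Fin 3) ≃ᵃⁱ[ℝ] EuclideanSpace ℝ (Fin 3), G 0 = q →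
      ∀ z : EuclideanSpace ℝ (Fin 3), ‖z‖ ≤ 2 * h → dist q (G z) ≤ r ∧ dist p (G z) ≤ r := by
    intro G hG0 z hz
    have hdq : dist q (G z) = ‖z‖ := by
      rw [← hG0, G.dist_map, dist_comm, dist_zero_right]
    exact ⟨by linarith, by linarith [dist_triangle p q (G z)]⟩
  apply Set.Subset.antisymm
  · apply image_subset_image_of_local ha h1 h2 Gp Gq (hGp0.trans hGq0.symm)
    intro z hz hzn
    obtain ⟨hq', hp'⟩ := key Gp hGp0 z hzn
    exact C1q _ (C2p' _ (Set.mem_image_of_mem _ hz) hp') hq'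
  · apply image_subset_image_of_local ha h1 h2 Gq Gp (hGq0.trans hGp0.symm)
    intro z hz hzn
    obtain ⟨hq', hp'⟩ := key Gq hGq0 z hzn
    exact C1p _ (C2q' _ (Set.mem_image_of_mem _ hz) hq') hp'

/-- **Exact local hcp charts integrate** (version with `hcpStacking`): if `0 ∈ W` and every point
of `W` in the closed `R`-ball about `0` has an exact `r`-chart (`r ≥ 3a`), then one rigid image
of hcp matches `W` on the whole closed `R`-ball. [folklore] -/
theorem hcpCharts_integrate {a h r R : ℝ} (ha : 0 < a) (h1 : 39 / 50 * a ≤ h)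
    (h2 : h ≤ 17 / 20 * a) (hr : 3 * a ≤ r) (hR : 0 < R) {W : Set (EuclideanSpace ℝ (Fin 3))}
    (h0W : (0 : EuclideanSpace ℝ (Fin 3)) ∈ W)
    (hW : ∀ w ∈ W, ‖w‖ ≤ R → ∃ g : EuclideanSpace ℝ (Fin 3) ≃ᵃⁱ[ℝ] EuclideanSpace ℝ (Fin 3),
      (∀ w' ∈ W, dist w w' ≤ r → w' ∈ g '' hcpStacking a h) ∧
        (∀ z ∈ hcpStacking a h, dist w (g z) ≤ r → g z ∈ W)) :
    ∃ g : EuclideanSpace ℝ (Fin 3) ≃ᵃⁱ[ℝ] EuclideanSpace ℝ (Fin 3),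
      (∀ w' ∈ W, ‖w'‖ ≤ R → w' ∈ g '' hcpStacking a h) ∧
      (∀ z ∈ hcpStacking a h, ‖g z‖ ≤ R → g z ∈ W) := by
  have hh : 0 < h := by linarith
  have h2h : 2 * h ≤ r := by linarith
  -- the chart at the origin, recentred at the origin
  obtain ⟨g₀, C1₀, C2₀⟩ := hW 0 h0W (by simpa using hR.le)
  obtain ⟨z₀, hz₀, hz₀e⟩ := C1₀ 0 h0W (by rw [dist_self]; linarith)
  obtain ⟨G₀, hG₀0, hG₀S⟩ := exists_recentre g₀ hz₀
  rw [hz₀e] at hG₀0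
  have hG₀n : ∀ s, ‖G₀ s‖ = ‖s‖ := fun s => by
    rw [← dist_zero_right, ← hG₀0, G₀.dist_map, dist_zero_right]
  -- base of the induction: the origin
  have base : (0 : EuclideanSpace ℝ (Fin 3)) ∈ W ∧
      ∀ g : EuclideanSpace ℝ (Fin 3) ≃ᵃⁱ[ℝ] EuclideanSpace ℝ (Fin 3),
      (∀ w' ∈ W, dist 0 w' ≤ r → w' ∈ g '' hcpStacking a h) →
        (∀ z ∈ hcpStacking a h, dist 0 (g z) ≤ r → g z ∈ W) →
        g '' hcpStacking a h = g₀ '' hcpStacking a h :=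
    ⟨h0W, fun g C1 C2 => (charts_align ha h1 h2 C1₀ C2₀ C1 C2 (by rw [dist_self]; linarith)
      h0W ⟨z₀, hz₀, hz₀e⟩).symm⟩
  -- numerics of one descent step
  have hc0 : 0 < min (a ^ 2) (h ^ 2 - a ^ 2 / 3) := lt_min (by positivity) (by nlinarith)
  have hstep : max (a ^ 2) (a ^ 2 / 3 + h ^ 2) ≤ (r - 2 * h) ^ 2 := by
    have hr2 : 13 / 10 * a ≤ r - 2 * h := by linarith
    have := pow_le_pow_left₀ (by positivity) hr2 2
    apply max_le <;> nlinarith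
  -- (C) induction along decreasing norm inside the base image
  have hQ : ∀ x ∈ g₀ '' hcpStacking a h, ‖x‖ ≤ R →
      x ∈ W ∧ ∀ g : EuclideanSpace ℝ (Fin 3) ≃ᵃⁱ[ℝ] EuclideanSpace ℝ (Fin 3),
        (∀ w' ∈ W, dist x w' ≤ r → w' ∈ g '' hcpStacking a h) →
        (∀ z ∈ hcpStacking a h, dist x (g z) ≤ r → g z ∈ W) →
        g '' hcpStacking a h = g₀ '' hcpStacking a h := by
    intro x hx hxR
    obtain ⟨n, hn⟩ := exists_nat_ge (‖x‖ ^ 2 / min (a ^ 2) (h ^ 2 - a ^ 2 / 3))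
    have hxn := (div_le_iff₀ hc0).1 hn
    clear hn
    induction n generalizing x with
    | zero =>
      obtain rfl : x = 0 := by
        have : ‖x‖ ^ 2 ≤ 0 := by simpa using hxn
        exact norm_eq_zero.1 (by nlinarith [norm_nonneg x])
      exact base
    | succ n ih =>
      by_cases hx0 : x = 0
      · subst hx0
        exact base
      rw [← hG₀S] at hx
      obtain ⟨s, hs, rfl⟩ := hx
      have hs0 : s ≠ 0 := fun h0 => hx0 (by rw [h0, hG₀0])
      obtain ⟨s', hs', hd, hn'⟩ := exists_closer_hcp_site a h hs hs0
      have hx' : G₀ s' ∈ g₀ '' hcpStacking a h := hG₀S ▸ Set.mem_image_of_mem _ hs'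
      rw [hG₀n] at hxR hxn
      have hn's : ‖G₀ s'‖ ^ 2 ≤ n * min (a ^ 2) (h ^ 2 - a ^ 2 / 3) := by
        rw [hG₀n]; push_cast at hxn; linarith
      have hR' : ‖G₀ s'‖ ≤ R := by
        rw [hG₀n]
        have : ‖s'‖ ^ 2 ≤ ‖s‖ ^ 2 := by linarith [hc0.le]
        nlinarith [norm_nonneg s, norm_nonneg s']
      obtain ⟨hW', hal'⟩ := ih _ hx' hR' hn's
      obtain ⟨g', C1', C2'⟩ := hW _ hW' hR'
      have hg'S := hal' g' C1' C2'
      have hdist : dist (G₀ s') (G₀ s) ≤ r - 2 * h := by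
        rw [G₀.dist_map, dist_comm]
        have hd2 : dist s s' ^ 2 ≤ (r - 2 * h) ^ 2 := hd.trans hstep
        nlinarith [dist_nonneg (x := s) (y := s')]
      have hxX : G₀ s ∈ g' '' hcpStacking a h := by
        rw [hg'S, ← hG₀S]; exact Set.mem_image_of_mem _ hs
      have hxW : G₀ s ∈ W := by
        obtain ⟨t, ht, hte⟩ := hxX
        exact hte ▸ C2' t ht (by rw [hte]; linarith)
      refine ⟨hxW, fun g C1 C2 => ?_⟩
      exact hg'S ▸ (charts_align ha h1 h2 C1' C2' C1 C2 (by linarith) hxW hxX).symm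
  -- (D) conclusion
  refine ⟨g₀, fun w' hw' hw'R => ?_,
    fun z hz hzR => (hQ _ (Set.mem_image_of_mem _ hz) hzR).1⟩
  by_cases hwr : ‖w'‖ ≤ r
  · exact C1₀ w' hw' (by rwa [dist_comm, dist_zero_right])
  have hw0 : 0 < ‖w'‖ := by linarith [not_le.1 hwr]
  have htr : r / 2 ≤ ‖w'‖ := by linarith
  have hr0 : 0 ≤ r / 2 / ‖w'‖ := div_nonneg (by linarith) (norm_nonneg _)
  -- pull `w'` towards the origin by `r/2`, then snap to a point of the base image
  set y : EuclideanSpace ℝ (Fin 3) := (1 - r / 2 / ‖w'‖) • w' with hy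
  have hcoef : 0 ≤ 1 - r / 2 / ‖w'‖ := by rw [sub_nonneg, div_le_one hw0]; exact htr
  have hyn : ‖y‖ = ‖w'‖ - r / 2 := by
    rw [hy, norm_smul, Real.norm_eq_abs, abs_of_nonneg hcoef]
    field_simp
  have hyd : dist y w' = r / 2 := by
    rw [hy, dist_eq_norm, sub_smul, one_smul, sub_sub_cancel_left, norm_neg, norm_smul,
      Real.norm_eq_abs, abs_of_nonneg hr0]
    field_simp
  obtain ⟨s, hs, hds⟩ := exists_hcp_site_near ha.ne' hh.ne' (G₀.symm y)
  have ht2 : 3 / 4 * a ^ 2 + h ^ 2 ≤ (r / 2) ^ 2 := by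
    have := pow_le_pow_left₀ (by positivity) (by linarith : 3 * a / 2 ≤ r / 2) 2
    nlinarith
  have hdsy : dist y (G₀ s) ≤ r / 2 := by
    have e : dist y (G₀ s) = dist (G₀.symm y) s := by
      rw [← G₀.dist_map (G₀.symm y) s, AffineIsometryEquiv.apply_symm_apply]
    rw [e]
    have : dist (G₀.symm y) s ^ 2 ≤ (r / 2) ^ 2 := hds.trans ht2
    nlinarith [dist_nonneg (x := G₀.symm y) (y := s)]
  have hxX : G₀ s ∈ g₀ '' hcpStacking a h := hG₀S ▸ Set.mem_image_of_mem _ hs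
  have hxR : ‖G₀ s‖ ≤ R := by
    linarith [(dist_comm y (G₀ s)).trans (dist_eq_norm (G₀ s) y), norm_le_insert' (G₀ s) y]
  obtain ⟨hxW, hal⟩ := hQ _ hxX hxR
  obtain ⟨gx, C1x, C2x⟩ := hW _ hxW hxR
  rw [← hal gx C1x C2x]
  apply C1x w' hw'
  linarith [dist_triangle (G₀ s) y w', dist_comm y (G₀ s)]

/-- **Exact local hcp charts integrate.**  Let `S = barlowStacking a h alternatingHagg` (hcp,
`0 < a`, `39/50 a ≤ h ≤ 17/20 a`), `3a ≤ r`, `0 < R`, and let `W ∋ 0` admit at every `w ∈ W`,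
`‖w‖ ≤ R`, an *exact* `r`-chart (a rigid motion `g` with `W = g '' S` on the closed `r`-ball
about `w`).  Then one rigid motion `g` satisfies `W = g '' S` on the closed `R`-ball about `0`:
overlapping charts are aligned by site rigidity (`hcp_mapsTo_of_mapsTo_ball`), the alignment
propagates from `0` through the base image (`exists_closer_hcp_site`), and the covering bound
`exists_hcp_site_near` reaches every point of `W`. [folklore] -/
theorem stub_hcpChartsIntegrate : ∀ (a h : ℝ), 0 < a → 39 / 50 * a ≤ h → h ≤ 17 / 20 * a → ∀ (r R : ℝ), 3 * a ≤ r → 0 < R → ∀ W : Set (EuclideanSpace ℝ (Fin 3)), (0 : EuclideanSpace ℝ (Fin 3)) ∈ W → (∀ w ∈ W, ‖w‖ ≤ R → ∃ g : EuclideanSpace ℝ (Fin 3) ≃ᵃⁱ[ℝ] EuclideanSpace ℝ (Fin 3), (∀ w' ∈ W, dist w w' ≤ r → w' ∈ g '' (Literature.MathematicalPhysics.StatisticalMechanics.barlowStacking a h Literature.MathematicalPhysics.StatisticalMechanics.alternatingHagg)) ∧ (∀ z ∈ (Literature.MathematicalPhysics.StatisticalMechanics.barlowStacking a h Literature.MathematicalPhysics.StatisticalMechanics.alternatingHagg),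 dist w (g z) ≤ r → g z ∈ W)) → ∃ g : EuclideanSpace ℝ (Fin 3) ≃ᵃⁱ[ℝ] EuclideanSpace ℝ (Fin 3), (∀ w' ∈ W, ‖w'‖ ≤ R → w' ∈ g '' (Literature.MathematicalPhysics.StatisticalMechanics.barlowStacking a h Literature.MathematicalPhysics.StatisticalMechanics.alternatingHagg)) ∧ (∀ z ∈ Literature.MathematicalPhysics.StatisticalMechanics.barlowStacking a h Literature.MathematicalPhysics.StatisticalMechanics.alternatingHagg, ‖g z‖ ≤ R → g z ∈ W) :=
  fun _a _h ha h1 h2 _r _R hr hR _W h0W hW => hcpCharts_integrate ha h1 h2 hr hR h0W hW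

end Summit.AtomisticToContinuum.Crystallization.Theorems.PricedHcpWindowsHcpCharts
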